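import Summits.QuantumFields.Balaban3D.Carriers.RadialContour
import Literature.MathematicalPhysics.QuantumFieldTheory.Balaban1983to89.Node00.TorusCoverBlockAveragingZd
import Literature.MathematicalPhysics.QuantumFieldTheory.Balaban1983to89.B8Lemma1NonAbelianRecLoops
import HarnessLib

/-!
# N07 [B11] (= [15] = [Balaban1985Variational]) ∕ N05-REC R7 — BRIDGE (B3): THE RADIAL CONTOUR `Γ_{y,x}` OF RECORD (`Balaban3D.Carriers.radialHol`, the axial data of
# `NrmOfRecordWide`) IS NODE 00's STAIRCASE WALK «last coordinate first», and READ THROUGH THE COVER it IS the engine's tree contour `treeWord ∕ axialFn` of the `ℤᵈ`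
# transcription re-rooted at the block CENTRE ((T3) of the N05-REC LEAD brief) — so the block axial gauges `AxialGauge (radialContourData …) (M^i U)` of N07's `Nrm` rows
# are, verbatim, the engine-shaped axial conditions `axialFn (avgIterZG …) (L·w) (L·w + offZ r) = 1` on the transcription's tower (FILE 39's top-anchored dictionary)

Cell `pub-ymgap`, width seat `pub-ymgap-dag-n07-w3` generation 9 (torus push-down lineage), N05-REC road item R7 (LEAD PEN dag-n05-e's proposal, cell bus 2026-08-29 02:57Z: R7 = the door
re-keys (D) + bridges; (D) needs, besides (B1) `Node00.TorusCoverGaugeAveragesZd` and (B2) `Node00.TorusCoverBlockAveragingZd`, the AXIAL rows of `HThm4Rec`'s `NrmOfRecordWide`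
(«`U^w` radial-axial below `j`: `AxialGauge (radialContourData (F.P K) i (SU N)) (Averaging.iter (avOfRecord F N K) i (U^w))`») read in the transcription's currency, where the twin
crown states them with the ENGINE's words `treeWord ∕ axialFn` — LEAD brief (T3): «the record's axial data … = the SINGLE staircase (1.7) from the block CENTRE, LAST coordinate first
(`RadialContour` `coordsDesc`, `radialHol`) … i.e. the engine's `treeWord ∕ axialFn` system up to (T2)'s base point», n05-d R2a-1 `treeWord_eq_stairRuns_reverse`).  THIS FILE proves
that located reading in the kernel.  `--kind proof --supports stmt-QuantumFields-20541 --as helper` (K0⁷; count-neutral; THEOREMS ONLY, 0 `def`; Summits-side because `radialContourData`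
is `Summit.QuantumFields.Balaban3D.Carriers`).  CONSUMED BY NAME, nothing modified: pub-balaban3d's `Carriers.RadialContour` (`fwdHol bwdHol moveHol pathHol radialHol coordsDesc
radialContourData`), NODE 00's `T4Continuum` (`walk walkEnd holAt axisRun stairRuns netDisp_axisRun`), `BlockAveraging.off`, `TorusGeometry` (`Site.blockSite val_blockSite val_emb
blockEquiv`), `AveragingReflection.two_mul_L_le_sitesPerDir`, FILE 39 (`hol_ιSU_coverLift hol_translate avgIterZG_coverLift_eq_iter coverAt_smul_add_ctrShift_succ`), dag-n07-e's
`TorusCoverLevels` (`coverAt emb_coverAt coverAt_surjective`), dag-n05-d's `B8Lemma1NonAbelianRecLoops.treeWord_eq_stairRuns_reverse`, n05-a's `B7Prop1Explicit` (`hol treeWord axialFn`),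
dag-n05-e's `BlockAveragingZd` (`offZ ctrShift avgIterZG`).  [B5] = [Balaban1984PropagatorsI]; [3] = [Balaban1985Averaging]; [I] = [Balaban1987RG1].

WHAT IS PROVED (kernel; every `Params`, any gauge group `G` in §1–§3, `SU(N)` under `ιSU` in §4–§5; standing range `j + 1 ≤ m + K`; NO estimate).
§1 `fwdHol_eq_holAt_walk`, `bwdHol_eq_holAt_walk` (coordinate segments = straight walks).
§2 `emb_add_off_eq_blockSite`, ★ `moveHol_blockSite_eq_holAt_walk` (ONE coordinate move of `Γ_{y,x}` «the shorter way round the torus» IS the run `axisRun μ (r_μ − (L−1)∕2)` — no wrap: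
   `|n_μ| ≤ (L−1)∕2`, `2L ≤ period`; the case analysis of pub-balaban3d's `RadialIdent.moveHol_eq_one` with values instead of `= 1`).
§3 `pathHol_blockSite_eq_holAt_walk` (induction along a duplicate-free coordinate list), ★★ `radialHol_blockSite_eq_holAt_walk` (`U(Γ_{y, blockSite y r}) = 𝒰(walk (emb y) (stairRuns (off r)
   coordsDesc))(U)`), `exists_eq_blockSite`, `emb_eq_blockSite_centre`, `radialHol_emb` (`U(Γ_{y,y}) = 1`).
§4 ON THE COVER: ★★ `hol_treeWord_coverLift_eq_radialHol` (`hol (ι∘U∘π_j) q (treeWord (offZ L r)) = ι(U(Γ_{y, blockSite y r}))` for `π_j q = emb y`), ★★ `axialFn_coverLift_eq_radialHol`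
   (`axialFn (ι∘U∘π_j) q (q + offZ L r) = ι(U(Γ_{y,x}))`), ★★★ `axialGauge_radial_iff_axialFn_coverLift` (`AxialGauge (radialContourData P j (SU N)) U ↔ ∀ z r, axialFn (ι∘U∘π_j)
   (L·z + (L−1)∕2·𝟙) (… + offZ L r) = 1`).
§5 ALONG THE TOWER (top-anchored, `i < k ≤ m + K`): `axialFn_translate`, ★★ `axialFn_avgIterZG_coverLift_eq_radialHol` (the engine's axial function of the transcription's guarded
   iterate `avgIterZG … i`, rooted at (43)'s base point `L·w`, = `ι(M^i(U)(Γ_{y,x}))` at `y = π_{i+1}(w + (L^{k−i−1}−1)∕2·𝟙)`), ★★★ `axialGauge_radial_iter_iff_axialFn_avgIterZG`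
   (`AxialGauge (radialContourData P i (SU N)) (M^i U) ↔ ∀ w r, axialFn (avgIterZG L δ_N (ι∘U∘π∘(·+(Lᵏ−1)∕2·𝟙)) i) (L·w) (L·w + offZ L r) = 1` — the shape the LEAD PEN gave
   the twin's `InAxZ` at `U₀ = 1`), ★★ `axialFn_avgIterZ_coverLift_eq_radialHol_of_small` ∕ `axialFn_avgIterZ_coverLift_eq_one_of_axialGauge` (the same on the UNGUARDED
   `avgIterZ` — the edition n05-d's `InAxOneZ` is stated on — under NODE 00's guard along the run: the torus axial gauge GIVES every `InAxOneZ` clause of the lift).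
§6 `coverLift_gaugeAct` (`lift(U^w) = (lift U)^{lift w}` at every level and anchor — `zdLift_gaugeAct` generalised; the residual `w` of `NrmOfRecordWide` travels with the field).
NOT HERE: the twin's own predicate names (`InAxZ ∕ InAxOneZ`, n05-d's R2 files — this file states their unfolded texts; the by-name row is one line when they land); the residual `w` and
the top gauge `h` of `NrmOfRecordWide` (R7 (D)); anything off the standing range.
HONEST FRAMING: count-neutral helper; lattice∕torus bookkeeping and list identities — nothing of [15]∕[3]∕[6]∕[I] analysis asserted or discharged; `HThm4Rec` UNDISCHARGED (caveat
(C-S3-1) stands); N07 ∕ N05 NOT discharged, N07 NOT claimable on road (β); K0⁷ ∕ K1⁹ NOT closed; counts unmoved; one finite 𝕋⁴ programme at fixed ε — R4 closes the conditional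
finite-𝕋⁴ rung `BalabanLadder.UV` only; the YM mass gap (Clay) is NOT proved by any of this; nothing continuum ∕ ℝ⁴ ∕ OS.  No `def`, no `sorry`, no `instance`, no `notation`.

References: [B5] (1.7), (1.10) pp. 18–19; [3] (7)–(9) p. 18, (11) p. 19, p. 24, (43) p. 24; [I] (0.1) p. 251, (0.3)–(0.4) pp. 252–253; [15] (147) p. 301 (the axial gauge on □̃).
-/

set_option autoImplicit false

noncomputable section

open scoped Matrix.Norms.L2Operator

namespace Summit.QuantumFields.YangMills.BalabanUVNodes.N07RadialHolCoverLift

open Literature.MathematicalPhysics.QuantumFieldTheory.Balaban1983to89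
open Literature.MathematicalPhysics.QuantumFieldTheory.Balaban1983to89.Node00
open Summit.QuantumFields.Balaban3D.Carriers
open T4Continuum (walk walkEnd holAt holAt_nil holAt_cons holAt_append walk_append walkEnd_apply axisRun stairRuns netDisp_axisRun)
open B15Eq112TorusCover (cover)
open B14DomainGeom (Pt)
open B7Prop1Explicit (hol treeWord axialFn)
open BlockAveragingZd (offZ)

variable {P : Params} {j : ℕ} {G : Type*} [GaugeGroup G]

/-! ## §1  Coordinate segments are straight walks -/

/-- The forward segment transport is the holonomy of the straight forward walk. [cite: Balaban1985Averaging, (9) p.18] -/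
theorem fwdHol_eq_holAt_walk (U : GaugeField P j G) (μ : Fin P.d) :
    ∀ (n : ℕ) (z : Site P j), fwdHol U μ n z = holAt U (walk z (List.replicate n (μ, true)))
  | 0, z => by simp [fwdHol, walk, holAt_nil]
  | n + 1, z => by
    rw [fwdHol, List.replicate_succ, walk, holAt_cons, fwdHol_eq_holAt_walk U μ n]
    simp

/-- The backward segment transport is the holonomy of the straight backward walk. [cite: Balaban1985Averaging, (7) p.18, (9) p.18] -/
theorem bwdHol_eq_holAt_walk (U : GaugeField P j G) (μ : Fin P.d) :
    ∀ (n : ℕ) (z : Site P j), bwdHol U μ n z = holAt U (walk z (List.replicate n (μ, false)))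
  | 0, z => by simp [bwdHol, walk, holAt_nil]
  | n + 1, z => by
    rw [bwdHol, List.replicate_succ, walk, holAt_cons, bwdHol_eq_holAt_walk U μ n]
    simp

/-! ## §2  Inside a block the «shorter way round the torus» is the centred offset `n_μ = r_μ − (L−1)∕2` -/

/-- `emb y + n_r = blockSite y r` coordinatewise on the torus (`n_r = off r = r − (L−1)∕2`, NODE 00's centred offset). [cite: Balaban1987RG1, (0.3) p.252] -/
theorem emb_add_off_eq_blockSite (y : Site P (j + 1)) (r : Fin P.d → Fin P.L) (μ : Fin P.d) :
    emb y μ + ((BlockAveraging.off r μ : ℤ) : ZMod (P.sitesPerDir j)) = Site.blockSite y r μ := by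
  simp only [emb, Site.blockSite, BlockAveraging.off, Nat.cast_add, Nat.cast_mul, Int.cast_sub, Int.cast_natCast]
  ring

/-- ★ **ONE COORDINATE MOVE OF `Γ_{y,x}` IS THE RUN OF THE CENTRED OFFSET** (standing range): from a point `z` at the centre in the coordinate `μ`, the move of
`radialHol` to the `μ`-coordinate of `x = blockSite y r` — «the shorter way round the torus» — is the straight walk `axisRun μ (r_μ − (L−1)∕2)` (no wrap:
`|n_μ| ≤ (L−1)∕2 < L ≤ period∕2`). [cite: Balaban1984PropagatorsI, (1.7) p.18; Balaban1987RG1, (0.3) p.252] -/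
theorem moveHol_blockSite_eq_holAt_walk (hj : j + 1 ≤ P.m + P.K) (U : GaugeField P j G) (y : Site P (j + 1)) (r : Fin P.d → Fin P.L) (μ : Fin P.d)
    {z : Site P j} (hz : z μ = emb y μ) :
    moveHol U μ (Site.blockSite y r μ) z = holAt U (walk z (axisRun μ (BlockAveraging.off r μ))) := by
  have hL := P.hL.2
  have hN := AveragingReflection.two_mul_L_le_sitesPerDir hj
  have hzv : (z μ).val = (y μ).val * P.L + (P.L - 1) / 2 := by rw [hz, Site.val_emb hj]
  have hxv : (Site.blockSite y r μ).val = (y μ).val * P.L + r μ := Site.val_blockSite hj y r μ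
  have hr := (r μ).isLt
  unfold moveHol
  by_cases hcase : (P.L - 1) / 2 ≤ (r μ : ℕ)
  · -- forward by `r_μ − (L−1)∕2`
    have hsub : (Site.blockSite y r μ - z μ).val = r μ - (P.L - 1) / 2 := by
      rw [ZMod.val_sub (by rw [hxv, hzv]; omega), hxv, hzv]; omega
    have hle : (Site.blockSite y r μ - z μ).val ≤ (z μ - Site.blockSite y r μ).val := by
      by_cases heq : Site.blockSite y r μ = z μ
      · simp [heq]
      · have hne : Site.blockSite y r μ - z μ ≠ 0 := sub_ne_zero.mpr heq
        have : (z μ - Site.blockSite y r μ) = -(Site.blockSite y r μ - z μ) := by ring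
        rw [this, ZMod.neg_val, if_neg hne, hsub]
        omega
    rw [if_pos hle, hsub, fwdHol_eq_holAt_walk]
    have hoff : BlockAveraging.off r μ = ((r μ - (P.L - 1) / 2 : ℕ) : ℤ) := by
      simp only [BlockAveraging.off]; omega
    rw [hoff, axisRun, Int.natAbs_natCast]
    simp
  · -- backward by `(L−1)∕2 − r_μ`
    rw [not_le] at hcase
    have hsub : (z μ - Site.blockSite y r μ).val = (P.L - 1) / 2 - r μ := by
      rw [ZMod.val_sub (by rw [hxv, hzv]; omega), hxv, hzv]; omega
    have hne : z μ - Site.blockSite y r μ ≠ 0 := by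
      intro h0
      have : (z μ - Site.blockSite y r μ).val = 0 := by rw [h0, ZMod.val_zero]
      omega
    have hgt : ¬ (Site.blockSite y r μ - z μ).val ≤ (z μ - Site.blockSite y r μ).val := by
      have : (Site.blockSite y r μ - z μ) = -(z μ - Site.blockSite y r μ) := by ring
      rw [this, ZMod.neg_val, if_neg hne, hsub]
      omega
    rw [if_neg hgt, hsub, bwdHol_eq_holAt_walk]
    have hoff : BlockAveraging.off r μ = -(((P.L - 1) / 2 - r μ : ℕ) : ℤ) := by
      simp only [BlockAveraging.off]; omega
    have hneg : ¬ (0 : ℤ) ≤ BlockAveraging.off r μ := by rw [hoff]; omega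
    rw [axisRun, hoff, Int.natAbs_neg, Int.natAbs_natCast]
    simp only [← hoff, decide_eq_false hneg]

/-! ## §3  `Γ_{y,x}` is the staircase walk from the centre, last coordinate first -/

/-- The coordinate path of `radialHol` along a duplicate-free list of coordinates, started at a point agreeing with the centre `emb y` on the listed coordinates, IS the
holonomy of the staircase walk `stairRuns (off r) l` (standing range). [cite: Balaban1984PropagatorsI, (1.7) p.18; Balaban1987RG1, (0.3) p.252] -/
theorem pathHol_blockSite_eq_holAt_walk (hj : j + 1 ≤ P.m + P.K) (U : GaugeField P j G) (y : Site P (j + 1)) (r : Fin P.d → Fin P.L) :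
    ∀ (l : List (Fin P.d)) (z : Site P j), l.Nodup → (∀ μ ∈ l, z μ = emb y μ) →
      pathHol U (Site.blockSite y r) l z = holAt U (walk z (stairRuns (BlockAveraging.off r) l))
  | [], z, _, _ => by simp [pathHol, stairRuns, walk, holAt_nil]
  | μ :: l, z, hnd, hctr => by
    rw [List.nodup_cons] at hnd
    rw [pathHol, stairRuns, walk_append, holAt_append, moveHol_blockSite_eq_holAt_walk hj U y r μ (hctr μ List.mem_cons_self)]
    have hend : walkEnd z (axisRun μ (BlockAveraging.off r μ)) = Function.update z μ (Site.blockSite y r μ) := by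
      funext ν
      rw [walkEnd_apply, netDisp_axisRun]
      by_cases h : μ = ν
      · subst h
        rw [if_pos rfl, Function.update_self, hctr μ List.mem_cons_self, emb_add_off_eq_blockSite]
      · rw [if_neg h, Function.update_of_ne (Ne.symm h), Int.cast_zero, add_zero]
    rw [hend, pathHol_blockSite_eq_holAt_walk hj U y r l _ hnd.2 fun ν hν => ?_]
    rw [Function.update_of_ne (ne_of_mem_of_not_mem hν hnd.1)]
    exact hctr ν (List.mem_cons_of_mem μ hν)

/-- ★★ **`U(Γ_{y,x})` OF RECORD IS THE STAIRCASE HOLONOMY**: for `x = blockSite y r ∈ B(y)`, `radialHol U y x = 𝒰(walk (emb y) (stairRuns (off r) coordsDesc))(U)` — print's (1.7)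
contour «first along the LAST coordinate» = NODE 00's staircase word of the centred offset `n_r` through the coordinates in descending order (standing range).
[cite: Balaban1984PropagatorsI, (1.7) p.18; Balaban1987RG1, (0.3) p.252] -/
theorem radialHol_blockSite_eq_holAt_walk (hj : j + 1 ≤ P.m + P.K) (U : GaugeField P j G) (y : Site P (j + 1)) (r : Fin P.d → Fin P.L) :
    radialHol U y (Site.blockSite y r) = holAt U (walk (emb y) (stairRuns (BlockAveraging.off r) (coordsDesc P))) :=
  pathHol_blockSite_eq_holAt_walk hj U y r (coordsDesc P) (emb y) (List.nodup_reverse.mpr (List.nodup_finRange P.d)) fun _ _ => rfl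

/-- Every site of `B(y)` is a `blockSite y r` (standing range; `TorusGeometry`'s `Site.blockEquiv`). [cite: Balaban1987RG1, (0.3) p.252] -/
theorem exists_eq_blockSite (hj : j + 1 ≤ P.m + P.K) {y : Site P (j + 1)} {x : Site P j} (hx : blockOf x = y) :
    ∃ r : Fin P.d → Fin P.L, x = Site.blockSite y r := by
  refine ⟨Site.blockEquiv hj y ⟨x, hx⟩, ?_⟩
  have h := (Site.blockEquiv hj y).symm_apply_apply ⟨x, hx⟩
  exact (congrArg Subtype.val h).symm

/-- The centre is the block point of the central offset: `emb y = blockSite y ((L−1)∕2·𝟙)`. [cite: Balaban1987RG1, (0.3) p.252] -/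
theorem emb_eq_blockSite_centre (y : Site P (j + 1)) :
    emb y = Site.blockSite y (fun _ => ⟨(P.L - 1) / 2, by have := P.hL.2; omega⟩) := by
  funext μ
  simp [emb, Site.blockSite]

/-- At the central offset the staircase word is empty, so `radialHol U y (emb y) = 1` (standing range). [cite: Balaban1984PropagatorsI, (1.7) p.18] -/
theorem radialHol_emb (hj : j + 1 ≤ P.m + P.K) (U : GaugeField P j G) (y : Site P (j + 1)) : radialHol U y (emb y) = 1 := by
  rw [emb_eq_blockSite_centre y, radialHol_blockSite_eq_holAt_walk hj]
  have h0 : (BlockAveraging.off (P := P) fun _ : Fin P.d => (⟨(P.L - 1) / 2, by have := P.hL.2; omega⟩ : Fin P.L)) = 0 := by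
    funext μ; simp [BlockAveraging.off]
  rw [h0]
  have hnil : ∀ l : List (Fin P.d), stairRuns (0 : Fin P.d → ℤ) l = [] := by
    intro l; induction l with
    | nil => rfl
    | cons a l ih => simp [stairRuns, axisRun, ih]
  rw [hnil]
  simp [walk, holAt_nil]

/-! ## §4  On the cover: `Γ_{y,x}` of record = the engine's `treeWord ∕ axialFn` of the transcription, re-rooted at the centre ((T3) of the N05-REC LEAD brief) -/

section Cover

variable (N : ℕ) [NeZero N]

/-- ★★ **THE RADIAL CONTOUR OF RECORD UNDER THE COVER**: at a base point `q` over the centre, `π_j q = emb y`, the `ℤᵈ` holonomy of the lift along the engine's TREE CONTOUR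
`treeWord (offZ L r)` (n05-d: `treeWord = stairRuns · (finRange d).reverse` — last coordinate first) IS the embedded `U(Γ_{y,x})` of record at `x = blockSite y r`.
[cite: Balaban1984PropagatorsI, (1.7) p.18; Balaban1985Averaging, p.24; Balaban1987RG1, (0.3) p.252] -/
theorem hol_treeWord_coverLift_eq_radialHol (hj : j + 1 ≤ P.m + P.K) (U : GaugeField P j (SU N)) {q : Pt P.d} {y : Site P (j + 1)}
    (hq : coverAt P j q = emb y) (r : Fin P.d → Fin P.L) :
    hol (fun x μ => ιSU N (U ⟨coverAt P j x, μ⟩)) q (treeWord (offZ P.L r)) = ιSU N (radialHol U y (Site.blockSite y r)) := by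
  rw [B8Lemma1NonAbelianRecLoops.treeWord_eq_stairRuns_reverse, hol_ιSU_coverLift, hq, radialHol_blockSite_eq_holAt_walk hj]
  rfl

/-- ★★ **THE ENGINE's AXIAL FUNCTION OF THE LIFT, ROOTED AT THE CENTRE, IS THE RADIAL CONTOUR OF RECORD**: `axialFn (ι∘U∘π_j) q (q + offZ L r) = ι(U(Γ_{y, blockSite y r}))` for `π_j q = emb y`.
[cite: Balaban1985Averaging, p.24; Balaban1984PropagatorsI, (1.7) p.18; Balaban1987RG1, (0.3) p.252] -/
theorem axialFn_coverLift_eq_radialHol (hj : j + 1 ≤ P.m + P.K) (U : GaugeField P j (SU N)) {q : Pt P.d} {y : Site P (j + 1)}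
    (hq : coverAt P j q = emb y) (r : Fin P.d → Fin P.L) :
    axialFn (fun x μ => ιSU N (U ⟨coverAt P j x, μ⟩)) q (q + offZ P.L r) = ιSU N (radialHol U y (Site.blockSite y r)) := by
  rw [axialFn, add_sub_cancel_left, hol_treeWord_coverLift_eq_radialHol N hj U hq]

/-- ★★★ **THE BLOCK AXIAL GAUGE OF RECORD ↔ THE ENGINE's AXIAL CONDITION ON THE LIFT** (standing range): `U` is in the axial gauge of the (1.7) contour system
`radialContourData` (`U(Γ_{y,x}) = 1`, `x ∈ B(y)`, `x ≠ y`) iff, for every coarse `z ∈ ℤᵈ` and every offset `r`, the lift's `axialFn` rooted at the block centre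
`q_z = L·z + (L−1)∕2·𝟙` is `1` at `q_z + offZ L r` (at the centre itself both sides are trivially `1`). [cite: Balaban1984PropagatorsI, (1.7), (1.10) pp.18–19; Balaban1985Averaging, p.24] -/
theorem axialGauge_radial_iff_axialFn_coverLift (hj : j + 1 ≤ P.m + P.K) (U : GaugeField P j (SU N)) :
    AxialGauge (radialContourData P j (SU N)) U ↔
      ∀ (z : Pt P.d) (r : Fin P.d → Fin P.L),
        axialFn (fun x μ => ιSU N (U ⟨coverAt P j x, μ⟩)) (fun μ => (P.L : ℤ) * z μ + ((P.L - 1) / 2 : ℕ))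
          ((fun μ => (P.L : ℤ) * z μ + ((P.L - 1) / 2 : ℕ)) + offZ P.L r) = 1 := by
  constructor
  · intro hax z r
    have hq : coverAt P j (fun μ => (P.L : ℤ) * z μ + ((P.L - 1) / 2 : ℕ)) = emb (coverAt P (j + 1) z) := (emb_coverAt hj z).symm
    rw [axialFn_coverLift_eq_radialHol N hj U hq]
    by_cases hc : Site.blockSite (coverAt P (j + 1) z) r = emb (coverAt P (j + 1) z)
    · rw [hc, radialHol_emb hj, map_one]
    · rw [← radialContourData_holTo, hax _ _ (Site.blockOf_blockSite hj _ r) hc, map_one]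
  · intro h y x hx hne
    obtain ⟨z, rfl⟩ := coverAt_surjective (P := P) (j + 1) y
    obtain ⟨r, rfl⟩ := exists_eq_blockSite hj hx
    have hq : coverAt P j (fun μ => (P.L : ℤ) * z μ + ((P.L - 1) / 2 : ℕ)) = emb (coverAt P (j + 1) z) := (emb_coverAt hj z).symm
    have hinj : Function.Injective (ιSU N) := fun a b hab => by
      apply Subtype.ext
      have := congrArg (fun u : (MatA N)ˣ => (u : MatA N)) hab
      simpa [coe_ιSU] using this
    rw [radialContourData_holTo]
    apply hinj
    rw [map_one, ← axialFn_coverLift_eq_radialHol N hj U hq r]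
    exact h z r

end Cover

/-! ## §5  Along the tower: the block axial gauges of `M^i(U)` ↔ the engine's axial condition on the transcription's `avgIterZG`, top-anchored (FILE 39's dictionary) -/

section Tower

variable (N : ℕ) [NeZero N]

/-- The engine's axial function of a translated configuration. [cite: Balaban1985Averaging, p.24] -/
theorem axialFn_translate {d : ℕ} {H : Type*} [Group H] (V : B7Prop1Explicit.Site d → Fin d → H) (t y x : B7Prop1Explicit.Site d) :
    axialFn (fun x' μ => V (x' + t) μ) y x = axialFn V (y + t) (x + t) := by
  unfold axialFn
  rw [hol_translate, add_sub_add_right_eq_sub]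

/-- ★★ **THE RADIAL CONTOURS OF `M^i(U)` READ ON THE TRANSCRIPTION's `i`-TH ITERATE** (standing range `i < k ≤ m + K`, top-anchored as FILE 39): for the lift of the finest field anchored
at `(Lᵏ−1)∕2·𝟙`, the engine's axial function of the guarded iterate `avgIterZG … i`, rooted at the base point `L·w` of (43) and evaluated at the block point `L·w + offZ L r`, IS the
embedded `M^i(U)(Γ_{y,x})` of record at `y = π_{i+1}(w + (L^{k−i−1}−1)∕2·𝟙)`, `x = blockSite y r`.
[cite: Balaban1984PropagatorsI, (1.7) p.18; Balaban1985Averaging, p.24, (43) p.24; Balaban1987RG1, (0.3)–(0.4) pp.252–253] -/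
theorem axialFn_avgIterZG_coverLift_eq_radialHol {k : ℕ} (hk : k ≤ P.m + P.K) (U : GaugeField P 0 (SU N)) {i : ℕ} (hi : i < k) (w : Pt P.d)
    (r : Fin P.d → Fin P.L) :
    axialFn (BlockAveragingZd.avgIterZG (𝔸 := MatA N) P.L (ExpMeanLog.deltaSU (Fin N))
          (fun x μ => ιSU N (U ⟨cover P (x + fun _ => ((BlockAveragingZd.ctrShift P.L k : ℕ) : ℤ)), μ⟩)) i)
        ((P.L : ℤ) • w) ((P.L : ℤ) • w + offZ P.L r) =
      ιSU N (radialHol (Averaging.iter (fun _ => BlockAveraging.blockAvg ExpMeanLog.expMeanLogSU) i U)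
        (coverAt P (i + 1) (w + fun _ => ((BlockAveragingZd.ctrShift P.L (k - (i + 1)) : ℕ) : ℤ)))
        (Site.blockSite (coverAt P (i + 1) (w + fun _ => ((BlockAveragingZd.ctrShift P.L (k - (i + 1)) : ℕ) : ℤ))) r)) := by
  have hkj : k - i = (k - (i + 1)) + 1 := by omega
  rw [avgIterZG_coverLift_eq_iter N hk U i hi.le, hkj]
  refine (axialFn_translate (fun x μ => ιSU N (Averaging.iter (fun _ => BlockAveraging.blockAvg ExpMeanLog.expMeanLogSU) i U ⟨coverAt P i x, μ⟩))
    (fun _ => ((BlockAveragingZd.ctrShift P.L (k - (i + 1) + 1) : ℕ) : ℤ)) ((P.L : ℤ) • w) ((P.L : ℤ) • w + offZ P.L r)).trans ?_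
  rw [add_right_comm]
  exact axialFn_coverLift_eq_radialHol N (Nat.le_trans hi hk) _ (coverAt_smul_add_ctrShift_succ (Nat.le_trans hi hk) (k - (i + 1)) w) r

/-- ★★★ **THE BLOCK AXIAL GAUGE OF `M^i(U)` ↔ THE ENGINE's AXIAL CONDITION ON `avgIterZG … i` AT THE BASE POINTS OF (43)** (standing range `i < k ≤ m + K`, top-anchored): the rows
«`U^w` radial-axial below `j`» of N07's `NrmOfRecordWide` (`AxialGauge (radialContourData P i (SU N)) (M^i(U^w))`) in the transcription's currency — exactly the shape the LEAD PEN gave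
the twin's `InAxZ` («`axialFn (avgIterZ L W n) (L•z) x = axialFn (avgIterZ L U₀ n) (L•z) x` on the centred blocks», `U₀ = 1`).
[cite: Balaban1984PropagatorsI, (1.10) p.19; Balaban1985Averaging, p.24; Balaban1987RG1, (0.3) p.252] -/
theorem axialGauge_radial_iter_iff_axialFn_avgIterZG {k : ℕ} (hk : k ≤ P.m + P.K) (U : GaugeField P 0 (SU N)) {i : ℕ} (hi : i < k) :
    AxialGauge (radialContourData P i (SU N)) (Averaging.iter (fun _ => BlockAveraging.blockAvg ExpMeanLog.expMeanLogSU) i U) ↔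
      ∀ (w : Pt P.d) (r : Fin P.d → Fin P.L),
        axialFn (BlockAveragingZd.avgIterZG (𝔸 := MatA N) P.L (ExpMeanLog.deltaSU (Fin N))
          (fun x μ => ιSU N (U ⟨cover P (x + fun _ => ((BlockAveragingZd.ctrShift P.L k : ℕ) : ℤ)), μ⟩)) i)
          ((P.L : ℤ) • w) ((P.L : ℤ) • w + offZ P.L r) = 1 := by
  have hik : i + 1 ≤ P.m + P.K := Nat.le_trans hi hk
  rw [axialGauge_radial_iff_axialFn_coverLift N hik]
  have hkj : k - i = (k - (i + 1)) + 1 := by omega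
  constructor
  · intro h w r
    rw [axialFn_avgIterZG_coverLift_eq_radialHol N hk U hi w r,
      ← axialFn_coverLift_eq_radialHol N hik _ (coverAt_smul_add_ctrShift_succ hik (k - (i + 1)) w) r]
    have := h (w + fun _ => ((BlockAveragingZd.ctrShift P.L (k - (i + 1)) : ℕ) : ℤ)) r
    convert this using 2 <;> (funext μ; simp only [Pi.add_apply, Pi.smul_apply, smul_eq_mul]; push_cast
      [BlockAveragingZd.ctrShift_succ P.hL.1 (k - (i + 1))]; ring)
  · intro h z r
    -- write the centre base point `L·z + (L−1)∕2·𝟙` as `L·w + ctrShift(k−i)·𝟙 − …`: take `w := z − ctrShift(k−i−1)·𝟙`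
    have hw := h (z - fun _ => ((BlockAveragingZd.ctrShift P.L (k - (i + 1)) : ℕ) : ℤ)) r
    rw [axialFn_avgIterZG_coverLift_eq_radialHol N hk U hi, sub_add_cancel,
      ← axialFn_coverLift_eq_radialHol N hik _ (emb_coverAt hik z).symm r] at hw
    exact hw

/-- ★★ **THE SAME ON THE UNGUARDED RECURSION `avgIterZ` (the edition n05-d's `InAxOneZ ∕ InAxZ` are stated on), on the small-field domain of the run**: if every torus average
`M^j(U)`, `j < k`, is inside NODE 00's guard at every coarse bond (FILE 39's `avgIterZ_coverLift_eq_iter_of_small`), then for `i < k`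
`axialFn (avgIterZ L (ι∘U∘π∘(·+(Lᵏ−1)∕2·𝟙)) i) (L·w) (L·w + offZ L r) = ι(M^i(U)(Γ_{y,x}))`, `y = π_{i+1}(w + (L^{k−i−1}−1)∕2·𝟙)`, `x = blockSite y r` — the clause of `InAxOneZ`
(`axialFn (avgIterZ L W n) (L•z) (L•z + offZ L r) = 1`) is literally «`M^n(U)` radial-axial at that block point». [cite: Balaban1985RegularSpaces, (1.19) p.79, (1.132) p.99; Balaban1984PropagatorsI, (1.7) p.18] -/
theorem axialFn_avgIterZ_coverLift_eq_radialHol_of_small {k : ℕ} (hk : k ≤ P.m + P.K) (U : GaugeField P 0 (SU N))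
    (hs : ∀ j, j < k → ∀ c : PBond P (j + 1),
      BlockAveraging.Small ExpMeanLog.expMeanLogSU (Averaging.iter (fun _ => BlockAveraging.blockAvg ExpMeanLog.expMeanLogSU) j U) c)
    {i : ℕ} (hi : i < k) (w : Pt P.d) (r : Fin P.d → Fin P.L) :
    axialFn (BlockAveragingZd.avgIterZ (𝔸 := MatA N) P.L
          (fun x μ => ιSU N (U ⟨cover P (x + fun _ => ((BlockAveragingZd.ctrShift P.L k : ℕ) : ℤ)), μ⟩)) i)
        ((P.L : ℤ) • w) ((P.L : ℤ) • w + offZ P.L r) =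
      ιSU N (radialHol (Averaging.iter (fun _ => BlockAveraging.blockAvg ExpMeanLog.expMeanLogSU) i U)
        (coverAt P (i + 1) (w + fun _ => ((BlockAveragingZd.ctrShift P.L (k - (i + 1)) : ℕ) : ℤ)))
        (Site.blockSite (coverAt P (i + 1) (w + fun _ => ((BlockAveragingZd.ctrShift P.L (k - (i + 1)) : ℕ) : ℤ))) r)) := by
  have hkj : k - i = (k - (i + 1)) + 1 := by omega
  rw [avgIterZ_coverLift_eq_iter_of_small N hk U hs i hi.le, hkj]
  refine (axialFn_translate (fun x μ => ιSU N (Averaging.iter (fun _ => BlockAveraging.blockAvg ExpMeanLog.expMeanLogSU) i U ⟨coverAt P i x, μ⟩))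
    (fun _ => ((BlockAveragingZd.ctrShift P.L (k - (i + 1) + 1) : ℕ) : ℤ)) ((P.L : ℤ) • w) ((P.L : ℤ) • w + offZ P.L r)).trans ?_
  rw [add_right_comm]
  exact axialFn_coverLift_eq_radialHol N (Nat.le_trans hi hk) _ (coverAt_smul_add_ctrShift_succ (Nat.le_trans hi hk) (k - (i + 1)) w) r

/-- ★★ Hence, on the small-field domain, the block axial gauge of `M^i(U)` GIVES every clause of the twin's `InAxOneZ` for the lift (all base points `L·w`, all offsets).
[cite: Balaban1985RegularSpaces, (1.19) p.79, (1.132) p.99; Balaban1984PropagatorsI, (1.10) p.19] -/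
theorem axialFn_avgIterZ_coverLift_eq_one_of_axialGauge {k : ℕ} (hk : k ≤ P.m + P.K) (U : GaugeField P 0 (SU N))
    (hs : ∀ j, j < k → ∀ c : PBond P (j + 1),
      BlockAveraging.Small ExpMeanLog.expMeanLogSU (Averaging.iter (fun _ => BlockAveraging.blockAvg ExpMeanLog.expMeanLogSU) j U) c)
    {i : ℕ} (hi : i < k) (hax : AxialGauge (radialContourData P i (SU N)) (Averaging.iter (fun _ => BlockAveraging.blockAvg ExpMeanLog.expMeanLogSU) i U))
    (w : Pt P.d) (r : Fin P.d → Fin P.L) :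
    axialFn (BlockAveragingZd.avgIterZ (𝔸 := MatA N) P.L
          (fun x μ => ιSU N (U ⟨cover P (x + fun _ => ((BlockAveragingZd.ctrShift P.L k : ℕ) : ℤ)), μ⟩)) i)
        ((P.L : ℤ) • w) ((P.L : ℤ) • w + offZ P.L r) = 1 := by
  rw [axialFn_avgIterZ_coverLift_eq_radialHol_of_small N hk U hs hi w r]
  set y := coverAt P (i + 1) (w + fun _ => ((BlockAveragingZd.ctrShift P.L (k - (i + 1)) : ℕ) : ℤ)) with hy
  by_cases hc : Site.blockSite y r = emb y
  · rw [hc, radialHol_emb (Nat.le_trans hi hk), map_one]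
  · rw [← radialContourData_holTo, hax y _ (Site.blockOf_blockSite (Nat.le_trans hi hk) y r) hc, map_one]

end Tower

/-! ## §6  Gauge actions under the level-`j` ∕ translated cover lifts (the residual `w` of `NrmOfRecordWide` travels with the field) -/

section GaugeAct

variable (N : ℕ) [NeZero N]

/-- **THE LEVEL-`j`, TRANSLATED COVER LIFT INTERTWINES THE GAUGE ACTIONS** ([3] (8) on the torus and on `ℤᵈ`): `lift(U^w) = (lift U)^{lift w}` for the lift `x ↦ ι(U⟨π_j(x + t), μ⟩)`,
`lift w = ι∘w∘π_j∘(·+t)` — dag-n07-e's `TorusCoverGaugeLift.zdLift_gaugeAct` at every level and anchor (so the residual `w` and the top gauge `h` of `NrmOfRecordWide` read on the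
transcription as engine gauge actions `B7Prop1Explicit.gaugeAct`). [cite: Balaban1985Averaging, (8) p.18; Balaban1987RG1, (0.1) p.251] -/
theorem coverLift_gaugeAct (j : ℕ) (t : Pt P.d) (w : GaugeTransf P j (SU N)) (U : GaugeField P j (SU N)) :
    (fun x μ => ιSU N (GaugeField.gaugeAct w U ⟨coverAt P j (x + t), μ⟩)) =
      B7Prop1Explicit.gaugeAct (fun x => ιSU N (w (coverAt P j (x + t)))) (fun x μ => ιSU N (U ⟨coverAt P j (x + t), μ⟩)) := by
  funext x μ
  simp only [B7Prop1Explicit.gaugeAct, GaugeField.gaugeAct, map_mul, map_inv, add_right_comm x (B7Prop1Explicit.e μ) t, coverAt_add_e]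
  rfl

end GaugeAct

end Summit.QuantumFields.YangMills.BalabanUVNodes.N07RadialHolCoverLift

end
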